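import Summits.CriticalPhenomena.Ising3DConformalLimit.Theorems.EnergyNotSigmaSquaredMoebiusLimitExistsLocallyBounded
import Literature.Probability.LatticeModels.CriticalAxisRatioRegularity
import Mathlib.Topology.MetricSpace.Algebra
import HarnessLib

/-!
# The cluster values of the pinned critical zoom at a fixed configuration form an interval
(line `only-interaction-breaks-moebius` of the crux `MoebiusLimitExists`, item stmt-CriticalPhenomena-1344;
registered stub `clusterValues_interval_cpt`)

Fix `n`, a non-coincident configuration `x₀`, and put `g(δ) := F_δ(x₀)` for the PINNED ZOOM
`F_δ(x) = ρ_pin(δ)ⁿ ⟨σ_{[x₁/δ]} ⋯ σ_{[xₙ/δ]}⟩_{β_c}` (`rescaledCorrelator (criticalCorr 3) rhoPin n δ x`), a real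
step function of the mesh `δ > 0`. Granted the two-point law `⟨σ₀σ_y⟩_{β_c}‖y‖₂^{2Δ} → c > 0` (item stmt-0634,
passed as data) and the sequential compactness (regular cluster points) and sequential equicontinuity on
compacts of the pinned zoom (conclusions of STUB 1, passed as hypotheses): if two cluster points take values
`Sa n x₀ ≤ v ≤ Sb n x₀`, some regular cluster point takes the value `v` at `x₀` (`clusterValues_interval_cpt`).

* STEP 1 (`smallOscillation_iv`, oscillation at scale `δ²`): `|g δ − g δ'| < ε` for `0 < δ' ≤ δ < δ₀(ε)`,
  `δ − δ' ≤ δ²`. Exactly `g(δ') = (ρ_pin(δ')/ρ_pin(δ))ⁿ F_δ((δ/δ') x₀)` (`rescaledCorrelator_of_pos_iv`: the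
  lattice approximation commutes with dilations); along `δ_j → 0⁺`, `δ_j − δ'_j ≤ δ_j²`, the ratio of
  renormalisations tends to `1` (`tendsto_rhoPin_div_iv`, two-point law at the two pinning sites), the dilated
  configuration tends to `x₀`, and sequential equicontinuity plus the local bound `pinnedZoomLocallyBounded` on
  a closed ball around `x₀` give a contradiction.
* STEP 2: `Sa n x₀`, `Sb n x₀` are limits of `g` along the two cluster points' own mesh sequences.
* STEP 3 (`exists_abs_sub_lt_of_chain_iv`, `exists_mesh_near_iv`, discrete intermediate values): between small
  meshes `m ≤ M` the finite chain `M, M − m², …, m` has consecutive `g`-values `ε`-close (STEP 1), so every value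
  between `g m` and `g M` is `ε`-close to some `g δ`, `δ ∈ [m, M]`; hence meshes `w_k → 0⁺` with `g(w_k) → v`,
  and the compactness hypothesis extracts a regular cluster point along a subsequence of `w`, with value `v`.

No definitions; the real analysis is elementary (no continuity in `δ`). References: folklore.
-/

noncomputable section

open Filter Topology Set Function Metric
open Literature.Probability.LatticeModels

namespace Summit.CriticalPhenomena.Ising3DConformalLimit.MoebiusLimitExistsOnlyInteraction

/-! ### Discrete intermediate values -/

/-- Discrete intermediate value property, increasing crossing: if `f 0 ≤ v ≤ f N` and consecutive values
of `f` are `ε`-close, some `f i` is `ε`-close to `v`. [folklore] -/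
theorem exists_abs_sub_lt_of_steps_up_iv {f : ℕ → ℝ} {v ε : ℝ} (hε : 0 < ε) (h0 : f 0 ≤ v)
    (hstep : ∀ i, |f (i + 1) - f i| < ε) : ∀ N : ℕ, v ≤ f N → ∃ i, |f i - v| < ε := by
  intro N
  induction N with
  | zero => exact fun hN => ⟨0, by rw [abs_lt]; constructor <;> linarith⟩
  | succ N ih =>
    intro hN
    by_cases h : v ≤ f N
    · exact ih h
    · refine ⟨N + 1, ?_⟩
      have h1 := (abs_lt.1 (hstep N)).2
      rw [abs_lt]
      constructor <;> linarith [not_le.1 h]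

/-- Discrete intermediate value property, decreasing crossing: if `f N ≤ v ≤ f 0` and consecutive values
of `f` are `ε`-close, some `f i` is `ε`-close to `v`. [folklore] -/
theorem exists_abs_sub_lt_of_steps_down_iv {f : ℕ → ℝ} {v ε : ℝ} (hε : 0 < ε) (h0 : v ≤ f 0)
    (hstep : ∀ i, |f (i + 1) - f i| < ε) : ∀ N : ℕ, f N ≤ v → ∃ i, |f i - v| < ε := by
  intro N
  induction N with
  | zero => exact fun hN => ⟨0, by rw [abs_lt]; constructor <;> linarith⟩
  | succ N ih =>
    intro hN
    by_cases h : f N ≤ v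
    · exact ih h
    · refine ⟨N + 1, ?_⟩
      have h1 := (abs_lt.1 (hstep N)).1
      rw [abs_lt]
      constructor <;> linarith [not_le.1 h]

/-- **The chain walk.** If `g : ℝ → ℝ` has oscillation `< ε` between meshes `0 < δ' ≤ δ < δ₀` with
`δ − δ' ≤ δ²`, then for `0 < m ≤ M < δ₀` every value between `g m` and `g M` is `ε`-close to `g δ` for
some `δ ∈ [m, M]`: walk down the finite chain `c₀ = M`, `c_{i+1} = max m (cᵢ − m²)`, which reaches `m`,
and apply the discrete intermediate value property. [folklore] -/
theorem exists_abs_sub_lt_of_chain_iv {g : ℝ → ℝ} {ε δ₀ m M : ℝ} (hε : 0 < ε)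
    (hosc : ∀ δ δ', 0 < δ' → δ' ≤ δ → δ < δ₀ → δ - δ' ≤ δ ^ 2 → |g δ - g δ'| < ε)
    (hm : 0 < m) (hmM : m ≤ M) (hM : M < δ₀) {v : ℝ}
    (hv : (g m ≤ v ∧ v ≤ g M) ∨ (g M ≤ v ∧ v ≤ g m)) :
    ∃ δ, m ≤ δ ∧ δ ≤ M ∧ |g δ - v| < ε := by
  -- the chain `c 0 = M`, `c (i+1) = max m (c i - m²)`
  obtain ⟨c, hc0, hcs⟩ : ∃ c : ℕ → ℝ, c 0 = M ∧ ∀ i, c (i + 1) = max m (c i - m ^ 2) :=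
    ⟨fun i => (fun x => max m (x - m ^ 2))^[i] M, rfl, fun i => Function.iterate_succ_apply' _ _ _⟩
  have hm2 : 0 < m ^ 2 := by positivity
  have hcm : ∀ i, m ≤ c i := fun i => by
    cases i with
    | zero => rw [hc0]; exact hmM
    | succ i => rw [hcs]; exact le_max_left _ _
  have hcM : ∀ i, c i ≤ M := fun i => by
    induction i with
    | zero => rw [hc0]
    | succ i ih => rw [hcs]; exact max_le hmM (by linarith)
  have hsucc : ∀ i, c (i + 1) ≤ c i := fun i => by rw [hcs]; exact max_le (hcm i) (by linarith)
  -- consecutive values of `g` along the chain are `ε`-close (STEP 1)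
  have hstep : ∀ i, |g (c (i + 1)) - g (c i)| < ε := by
    intro i
    rw [abs_sub_comm]
    refine hosc (c i) (c (i + 1)) (hm.trans_le (hcm _)) (hsucc i) ((hcM i).trans_lt hM) ?_
    have h1 : c i - m ^ 2 ≤ c (i + 1) := by rw [hcs]; exact le_max_right _ _
    linarith [pow_le_pow_left₀ hm.le (hcm i) 2]
  -- the chain reaches `m`
  have hbound : ∀ i : ℕ, c i ≤ max m (M - i * m ^ 2) := by
    intro i
    induction i with
    | zero =>
      rw [hc0, Nat.cast_zero, zero_mul, sub_zero]
      exact le_max_right _ _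
    | succ i ih =>
      rw [hcs]
      refine max_le (le_max_left _ _) ?_
      rcases le_total m (M - i * m ^ 2) with h | h
      · rw [max_eq_right h] at ih
        refine le_max_of_le_right ?_
        rw [show M - ((i + 1 : ℕ) : ℝ) * m ^ 2 = (M - i * m ^ 2) - m ^ 2 by push_cast; ring]
        linarith
      · rw [max_eq_left h] at ih
        exact le_max_of_le_left (by linarith)
  obtain ⟨N, hN⟩ := exists_nat_ge ((M - m) / m ^ 2)
  have hcN : c N = m := by
    refine le_antisymm ((hbound N).trans (max_le le_rfl ?_)) (hcm N)
    rw [div_le_iff₀ hm2] at hN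
    linarith
  -- discrete intermediate values along the chain
  rcases hv with ⟨h1, h2⟩ | ⟨h1, h2⟩
  · -- `g m ≤ v ≤ g M`: decreasing crossing from `g (c 0) = g M` to `g (c N) = g m`
    obtain ⟨i, hi⟩ := exists_abs_sub_lt_of_steps_down_iv (f := fun i => g (c i)) hε
      (show v ≤ g (c 0) by rw [hc0]; exact h2) hstep N (show g (c N) ≤ v by rw [hcN]; exact h1)
    exact ⟨c i, hcm i, hcM i, hi⟩
  · -- `g M ≤ v ≤ g m`: increasing crossing
    obtain ⟨i, hi⟩ := exists_abs_sub_lt_of_steps_up_iv (f := fun i => g (c i)) hε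
      (show g (c 0) ≤ v by rw [hc0]; exact h1) hstep N (show v ≤ g (c N) by rw [hcN]; exact h2)
    exact ⟨c i, hcm i, hcM i, hi⟩

/-- **Near values at small meshes.** If `g` has small oscillation below `δ₀` (STEP 1 with `ε`) and along two
mesh sequences `ua`, `ub → 0⁺` the values `g ∘ ua → A ≤ v`, `g ∘ ub → B ≥ v`, then below every `δ₁ > 0`
there is a mesh `δ` with `|g δ − v| < ε`. [folklore] -/
theorem exists_mesh_near_iv {g : ℝ → ℝ} {ε δ₀ δ₁ : ℝ} (hε : 0 < ε) (hδ₀ : 0 < δ₀) (hδ₁ : 0 < δ₁)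
    (hosc : ∀ δ δ', 0 < δ' → δ' ≤ δ → δ < δ₀ → δ - δ' ≤ δ ^ 2 → |g δ - g δ'| < ε)
    {ua ub : ℕ → ℝ} (hua : Tendsto ua atTop (𝓝[>] (0 : ℝ))) (hub : Tendsto ub atTop (𝓝[>] (0 : ℝ)))
    {A B v : ℝ} (hA : Tendsto (fun k => g (ua k)) atTop (𝓝 A))
    (hB : Tendsto (fun k => g (ub k)) atTop (𝓝 B)) (hAv : A ≤ v) (hvB : v ≤ B) :
    ∃ δ, 0 < δ ∧ δ < δ₁ ∧ |g δ - v| < ε := by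
  have hmin : 0 < min δ₀ δ₁ := lt_min hδ₀ hδ₁
  -- a small mesh of the first sequence with value near `A`
  have hea : ∀ᶠ i in atTop, 0 < ua i ∧ ua i < min δ₀ δ₁ :=
    (tendsto_nhdsWithin_iff.1 hua).2.and
      ((tendsto_nhdsWithin_iff.1 hua).1.eventually (eventually_lt_nhds hmin))
  have hga : ∀ᶠ i in atTop, |g (ua i) - A| < ε := by
    simpa only [Real.dist_eq] using Metric.tendsto_nhds.1 hA ε hε
  obtain ⟨i, ⟨hia0, hiam⟩, hia⟩ := (hea.and hga).exists
  -- a small mesh of the second sequence with value near `B`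
  have heb : ∀ᶠ j in atTop, 0 < ub j ∧ ub j < min δ₀ δ₁ :=
    (tendsto_nhdsWithin_iff.1 hub).2.and
      ((tendsto_nhdsWithin_iff.1 hub).1.eventually (eventually_lt_nhds hmin))
  have hgb : ∀ᶠ j in atTop, |g (ub j) - B| < ε := by
    simpa only [Real.dist_eq] using Metric.tendsto_nhds.1 hB ε hε
  obtain ⟨j, ⟨hjb0, hjbm⟩, hjb⟩ := (heb.and hgb).exists
  have haδ₀ : ua i < δ₀ := hiam.trans_le (min_le_left _ _)
  have haδ₁ : ua i < δ₁ := hiam.trans_le (min_le_right _ _)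
  have hbδ₀ : ub j < δ₀ := hjbm.trans_le (min_le_left _ _)
  have hbδ₁ : ub j < δ₁ := hjbm.trans_le (min_le_right _ _)
  rw [abs_lt] at hia hjb
  by_cases hva : v ≤ g (ua i)
  · exact ⟨ua i, hia0, haδ₁, by rw [abs_lt]; constructor <;> linarith [hia.2]⟩
  by_cases hvb : g (ub j) ≤ v
  · exact ⟨ub j, hjb0, hbδ₁, by rw [abs_lt]; constructor <;> linarith [hjb.1]⟩
  push Not at hva hvb
  -- `g (ua i) < v < g (ub j)`: walk between the two meshes
  have hv' : (g (min (ua i) (ub j)) ≤ v ∧ v ≤ g (max (ua i) (ub j))) ∨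
      (g (max (ua i) (ub j)) ≤ v ∧ v ≤ g (min (ua i) (ub j))) := by
    rcases le_total (ua i) (ub j) with h | h
    · rw [min_eq_left h, max_eq_right h]
      exact Or.inl ⟨hva.le, hvb.le⟩
    · rw [min_eq_right h, max_eq_left h]
      exact Or.inr ⟨hva.le, hvb.le⟩
  obtain ⟨δ, hmδ, hδM, hδv⟩ := exists_abs_sub_lt_of_chain_iv hε hosc (lt_min hia0 hjb0) min_le_max
    (max_lt haδ₀ hbδ₀) hv'
  exact ⟨δ, (lt_min hia0 hjb0).trans_le hmδ, hδM.trans_lt (max_lt haδ₁ hbδ₁), hδv⟩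

/-! ### The pinned zoom under a change of mesh -/

/-- `[((δ/δ') p)/δ] = [p/δ']` for `δ, δ' ≠ 0`: the lattice approximation commutes with dilations.
[folklore] -/
theorem latticeApprox_smul_iv {δ δ' : ℝ} (hδ : δ ≠ 0) (hδ' : δ' ≠ 0) (p : EuclideanSpace ℝ (Fin 3)) :
    latticeApprox δ ((δ / δ') • p) = latticeApprox δ' p := by
  funext j
  rw [latticeApprox_apply, latticeApprox_apply, PiLp.smul_apply, smul_eq_mul]
  congr 1
  field_simp

/-- **The pinned zoom at mesh `δ'` is the pinned zoom at mesh `δ ∈ (0,1]` at the dilated configuration**,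
up to the ratio of renormalisations: `F_{δ'}(x) = (ρ_pin(δ')/ρ_pin(δ))ⁿ F_δ((δ/δ') x)`. [folklore] -/
theorem rescaledCorrelator_of_pos_iv {δ δ' : ℝ} (hδ : δ ∈ Set.Ioc (0 : ℝ) 1) (hδ' : 0 < δ') (n : ℕ)
    (x : Fin n → EuclideanSpace ℝ (Fin 3)) :
    rescaledCorrelator (criticalCorr 3) rhoPin n δ' x =
      (rhoPin δ' / rhoPin δ) ^ n *
        rescaledCorrelator (criticalCorr 3) rhoPin n δ (fun i => (δ / δ') • x i) := by
  rw [rescaledCorrelator_apply, rescaledCorrelator_apply]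
  simp only [latticeApprox_smul_iv hδ.1.ne' hδ'.ne']
  rw [div_pow, ← mul_assoc, div_mul_cancel₀ _ (pow_ne_zero n (rhoPin_pos δ hδ).ne')]

/-- `⟨σ₀σ_{⌊1/δ⌋e₀}⟩ > 0` for `0 < δ ≤ 1` (`ρ_pin(δ)² = 1/⟨σ₀σ_{⌊1/δ⌋e₀}⟩ > 0`). [folklore] -/
theorem criticalTwoPoint_pin_pos_iv {δ : ℝ} (hδ : 0 < δ) (hδ1 : δ ≤ 1) :
    0 < criticalTwoPoint 3 (Pi.single 0 (⌊1 / δ⌋ : ℤ) : Site 3) := by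
  have h := pow_pos (rhoPin_pos δ ⟨hδ, hδ1⟩) 2
  rw [rhoPin_sq] at h
  exact inv_pos.1 h

/-- **The ratio of pinned renormalisations at comparable meshes tends to `1`.** Under the two-point law
`⟨σ₀σ_y⟩_{β_c}‖y‖₂^{2Δ} → c > 0`, along mesh sequences `a_j, b_j → 0⁺` with `b_j/a_j → 1`,
`ρ_pin(b_j)/ρ_pin(a_j) → 1`: `ρ_pin² = 1/⟨σ₀σ_{⌊1/δ⌋e₀}⟩` and `⟨σ₀σ_{⌊1/δ⌋e₀}⟩ δ^{-2Δ} → c` along both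
sequences (`tendsto_criticalTwoPoint_pin_mul_rpow`). [folklore] -/
theorem tendsto_rhoPin_div_iv {Δ c : ℝ} (hc : 0 < c)
    (hG : Tendsto (fun y : Site 3 => criticalTwoPoint 3 y * Real.sqrt (∑ i, ((y i : ℝ)) ^ 2) ^ (2 * Δ))
      cofinite (𝓝 c))
    {a b : ℕ → ℝ} (hua : Tendsto a atTop (𝓝[>] (0 : ℝ))) (hub : Tendsto b atTop (𝓝[>] (0 : ℝ)))
    (hs : Tendsto (fun j => b j / a j) atTop (𝓝 1)) :
    Tendsto (fun j => rhoPin (b j) / rhoPin (a j)) atTop (𝓝 1) := by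
  have hapos : ∀ᶠ j in atTop, 0 < a j := (tendsto_nhdsWithin_iff.1 hua).2
  have hbpos : ∀ᶠ j in atTop, 0 < b j := (tendsto_nhdsWithin_iff.1 hub).2
  have ha1 : ∀ᶠ j in atTop, a j ≤ 1 :=
    (tendsto_nhdsWithin_iff.1 hua).1.eventually (eventually_le_nhds one_pos)
  have hb1 : ∀ᶠ j in atTop, b j ≤ 1 :=
    (tendsto_nhdsWithin_iff.1 hub).1.eventually (eventually_le_nhds one_pos)
  have hA := tendsto_criticalTwoPoint_pin_mul_rpow (Δ := Δ) hG hua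
  have hB := tendsto_criticalTwoPoint_pin_mul_rpow (Δ := Δ) hG hub
  have hS : Tendsto (fun j => (b j / a j) ^ (2 * Δ)) atTop (𝓝 1) := by
    have h := hs.rpow_const (p := 2 * Δ) (Or.inl one_ne_zero)
    rwa [Real.one_rpow] at h
  -- the squared ratio
  have hsq : Tendsto (fun j => (rhoPin (b j) / rhoPin (a j)) ^ 2) atTop (𝓝 1) := by
    have hlim : Tendsto (fun j =>
        criticalTwoPoint 3 (Pi.single 0 (⌊1 / a j⌋ : ℤ) : Site 3) * a j ^ (-(2 * Δ)) /
          (criticalTwoPoint 3 (Pi.single 0 (⌊1 / b j⌋ : ℤ) : Site 3) * b j ^ (-(2 * Δ))) /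
          (b j / a j) ^ (2 * Δ)) atTop (𝓝 (c / c / 1)) :=
      (hA.div hB hc.ne').div hS one_ne_zero
    rw [div_self hc.ne', div_one] at hlim
    refine hlim.congr' ?_
    filter_upwards [hapos, hbpos, ha1, hb1] with j hja hjb hja1 hjb1
    have hGa := criticalTwoPoint_pin_pos_iv hja hja1
    have hGb := criticalTwoPoint_pin_pos_iv hjb hjb1
    have hpa : 0 < a j ^ (2 * Δ) := Real.rpow_pos_of_pos hja _
    have hpb : 0 < b j ^ (2 * Δ) := Real.rpow_pos_of_pos hjb _
    rw [div_pow, rhoPin_sq, rhoPin_sq, inv_div_inv, Real.rpow_neg hja.le, Real.rpow_neg hjb.le,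
      Real.div_rpow hjb.le hja.le]
    field_simp
  -- square roots
  have h := hsq.sqrt
  rw [Real.sqrt_one] at h
  refine h.congr' ?_
  filter_upwards [hapos, hbpos, ha1, hb1] with j hja hjb hja1 hjb1
  exact Real.sqrt_sq (div_pos (rhoPin_pos _ ⟨hjb, hjb1⟩) (rhoPin_pos _ ⟨hja, hja1⟩)).le

/-- Bookkeeping for STEP 1: if `Fb = R · Fy`, `|Fx − Fy| < ε/2`, `|Fy| ≤ B` and `|R − 1| · |B| < ε/2`,
then `|Fx − Fb| < ε`. [folklore] -/
theorem abs_sub_lt_of_ratio_iv {Fx Fy Fb R B ε : ℝ} (hb : Fb = R * Fy) (h1 : |Fx - Fy| < ε / 2)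
    (h2 : |Fy| ≤ B) (h3 : |R - 1| * |B| < ε / 2) : |Fx - Fb| < ε := by
  have e : Fx - Fb = (Fx - Fy) + (1 - R) * Fy := by
    rw [hb]
    ring
  rw [e]
  calc |(Fx - Fy) + (1 - R) * Fy| ≤ |Fx - Fy| + |(1 - R) * Fy| := abs_add_le _ _
    _ = |Fx - Fy| + |R - 1| * |Fy| := by rw [abs_mul, abs_sub_comm 1 R]
    _ < ε / 2 + ε / 2 := add_lt_add_of_lt_of_le h1
        ((mul_le_mul_of_nonneg_left (h2.trans (le_abs_self B)) (abs_nonneg _)).trans h3.le)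
    _ = ε := by ring

/-! ### STEP 1: small oscillation of the pinned zoom at scale `δ²` -/

/-- **STEP 1 — small oscillation in the mesh at scale `δ²`.** Under the two-point law and the sequential
equicontinuity of the pinned zoom on compacts, for fixed `n`, `x₀ ∈ NonCoincident` and `ε > 0` there is
`δ₀ > 0` with `|F_δ(x₀) − F_{δ'}(x₀)| < ε` whenever `0 < δ' ≤ δ < δ₀` and `δ − δ' ≤ δ²`. By contradiction
with sequences `δ_j, δ'_j`: `F_{δ'_j}(x₀) = (ρ_pin(δ'_j)/ρ_pin(δ_j))ⁿ F_{δ_j}((δ_j/δ'_j) x₀)` with ratio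
`→ 1` (`tendsto_rhoPin_div_iv`), `(δ_j/δ'_j) x₀ → x₀`, and equicontinuity plus the local bound
`pinnedZoomLocallyBounded` on a closed ball around `x₀` along `δ_j`. [folklore] -/
theorem smallOscillation_iv {Δ c : ℝ} (hc : 0 < c)
    (hG : Tendsto (fun y : Site 3 => criticalTwoPoint 3 y * Real.sqrt (∑ i, ((y i : ℝ)) ^ 2) ^ (2 * Δ))
      cofinite (𝓝 c))
    (Heq : ∀ u : ℕ → ℝ, Tendsto u atTop (𝓝[>] (0 : ℝ)) →
      ∀ (n : ℕ) (K : Set (Fin n → EuclideanSpace ℝ (Fin 3))), IsCompact K → K ⊆ NonCoincident 3 n →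
        ∀ ε > 0, ∃ η > 0, ∀ᶠ k in atTop, ∀ x ∈ K, ∀ y ∈ K, dist x y < η →
          |rescaledCorrelator (criticalCorr 3) rhoPin n (u k) x -
            rescaledCorrelator (criticalCorr 3) rhoPin n (u k) y| < ε)
    {n : ℕ} {x₀ : Fin n → EuclideanSpace ℝ (Fin 3)} (hx₀ : x₀ ∈ NonCoincident 3 n) {ε : ℝ}
    (hε : 0 < ε) :
    ∃ δ₀ > 0, ∀ δ δ', 0 < δ' → δ' ≤ δ → δ < δ₀ → δ - δ' ≤ δ ^ 2 →
      |rescaledCorrelator (criticalCorr 3) rhoPin n δ x₀ -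
        rescaledCorrelator (criticalCorr 3) rhoPin n δ' x₀| < ε := by
  by_contra H
  push Not at H
  choose a b hb0 hba hlt hsq hge using fun j : ℕ => H (1 / ((j : ℝ) + 1)) Nat.one_div_pos_of_nat
  -- the two mesh sequences `a j = δ_j`, `b j = δ'_j`
  have ha0 : ∀ j, 0 < a j := fun j => (hb0 j).trans_le (hba j)
  have ha1 : ∀ j, a j ≤ 1 := fun j => (hlt j).le.trans (by
    rw [div_le_one (by positivity)]
    exact le_add_of_nonneg_left (Nat.cast_nonneg _))
  have ha_lim : Tendsto a atTop (𝓝 0) :=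
    squeeze_zero (fun j => (ha0 j).le) (fun j => (hlt j).le) tendsto_one_div_add_atTop_nhds_zero_nat
  have hua : Tendsto a atTop (𝓝[>] (0 : ℝ)) :=
    tendsto_nhdsWithin_iff.2 ⟨ha_lim, Eventually.of_forall ha0⟩
  have hub : Tendsto b atTop (𝓝[>] (0 : ℝ)) :=
    tendsto_nhdsWithin_iff.2 ⟨squeeze_zero (fun j => (hb0 j).le) hba ha_lim, Eventually.of_forall hb0⟩
  -- `b j / a j → 1` and `a j / b j → 1`
  have hs : Tendsto (fun j => b j / a j) atTop (𝓝 1) := by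
    have h1 : Tendsto (fun j => 1 - a j) atTop (𝓝 1) := by simpa using ha_lim.const_sub 1
    refine tendsto_of_tendsto_of_tendsto_of_le_of_le h1 tendsto_const_nhds (fun j => ?_) (fun j => ?_)
    · rw [le_div_iff₀ (ha0 j), show (1 - a j) * a j = a j - a j ^ 2 by ring]
      linarith [hsq j]
    · exact div_le_one_of_le₀ (hba j) (ha0 j).le
  have ht : Tendsto (fun j => a j / b j) atTop (𝓝 1) := by
    simpa only [inv_div, inv_one] using hs.inv₀ one_ne_zero
  -- the ratio of renormalisations tends to `1`
  have hrn : Tendsto (fun j => (rhoPin (b j) / rhoPin (a j)) ^ n) atTop (𝓝 1) := by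
    simpa using (tendsto_rhoPin_div_iv hc hG hua hub hs).pow n
  -- the dilated configurations tend to `x₀`
  have hy : Tendsto (fun j => (fun i => (a j / b j) • x₀ i : Fin n → EuclideanSpace ℝ (Fin 3))) atTop
      (𝓝 x₀) := by
    exact tendsto_pi_nhds.2 fun i => by simpa using ht.smul_const (x₀ i)
  -- a compact ball of non-coincident configurations around `x₀`
  obtain ⟨r, hr0, hrK⟩ : ∃ r > 0, closedBall x₀ r ⊆ NonCoincident 3 n := by
    obtain ⟨r, hr0, hr⟩ := Metric.isOpen_iff.1 (isOpen_nonCoincident 3 n) x₀ hx₀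
    exact ⟨r / 2, half_pos hr0, (closedBall_subset_ball (half_lt_self hr0)).trans hr⟩
  have hK : IsCompact (closedBall x₀ r) := isCompact_closedBall x₀ r
  have hx₀K : x₀ ∈ closedBall x₀ r := mem_closedBall_self hr0.le
  -- equicontinuity and the local bound along `a`
  obtain ⟨η, hη, hEQ⟩ := Heq a hua n (closedBall x₀ r) hK hrK (ε / 2) (half_pos hε)
  obtain ⟨B, hB⟩ := pinnedZoomLocallyBounded Δ c hc hG a hua n (closedBall x₀ r) hK hrK
  have hyK : ∀ᶠ j in atTop,
      dist (fun i => (a j / b j) • x₀ i : Fin n → EuclideanSpace ℝ (Fin 3)) x₀ < min r η :=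
    Metric.tendsto_nhds.1 hy _ (lt_min hr0 hη)
  have hsmall : ∀ᶠ j in atTop, |(rhoPin (b j) / rhoPin (a j)) ^ n - 1| * |B| < ε / 2 := by
    have h := (hrn.sub_const 1).abs.mul_const |B|
    rw [sub_self, abs_zero, zero_mul] at h
    exact h.eventually (eventually_lt_nhds (half_pos hε))
  obtain ⟨j, hj1, hj2, hj3, hj4⟩ := (hEQ.and (hB.and (hyK.and hsmall))).exists
  -- at the index `j`: the identity and the estimates
  have hid := rescaledCorrelator_of_pos_iv ⟨ha0 j, ha1 j⟩ (hb0 j) n x₀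
  have hyK' : (fun i => (a j / b j) • x₀ i : Fin n → EuclideanSpace ℝ (Fin 3)) ∈ closedBall x₀ r :=
    mem_closedBall.2 (hj3.le.trans (min_le_left _ _))
  have hdist : dist x₀ (fun i => (a j / b j) • x₀ i : Fin n → EuclideanSpace ℝ (Fin 3)) < η := by
    rw [dist_comm]
    exact hj3.trans_le (min_le_right _ _)
  have hE := hj1 x₀ hx₀K _ hyK' hdist
  have hBy := hj2 _ hyK'
  exact absurd (abs_sub_lt_of_ratio_iv hid hE hBy hj4) (not_lt.2 (hge j))

/-! ### The stub -/

/-- **Registered stub `clusterValues_interval_cpt` of the line `only-interaction-breaks-moebius` — the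
cluster values at a fixed configuration form an interval.** Under the two-point law
`⟨σ₀σ_y⟩_{β_c}‖y‖₂^{2Δ} → c > 0` (item stmt-0634, passed as data), the sequential compactness of the pinned
zoom with regular cluster points and its sequential equicontinuity on compacts (conclusions of STUB 1, passed
as hypotheses): if two cluster points take the values `Sa n x₀ ≤ v ≤ Sb n x₀` at a non-coincident
configuration `x₀`, then some regular cluster point `S` has `S n x₀ = v`. STEP 1 `smallOscillation_iv`,
STEP 2 the endpoint values as limits along the cluster points' mesh sequences, STEP 3 the chain walk
`exists_mesh_near_iv` producing meshes `w_k → 0⁺` with `F_{w_k}(x₀) → v`, along a subsequence of which the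
compactness hypothesis extracts the regular cluster point. [folklore] -/
theorem clusterValues_interval_cpt : ∀ (Δ c : ℝ), 0 < c → Tendsto (fun y : Site 3 => criticalTwoPoint 3 y * Real.sqrt (∑ i, ((y i : ℝ)) ^ 2) ^ (2 * Δ)) cofinite (𝓝 c) → (∀ u : ℕ → ℝ, Tendsto u atTop (𝓝[>] (0 : ℝ)) → ∃ (φ : ℕ → ℕ) (S : CorrFamily 3), StrictMono φ ∧ IsRegular S ∧ ∀ n, TendstoLocallyUniformlyOn (fun k => rescaledCorrelator (criticalCorr 3) rhoPin n (u (φ k))) (S n) atTop (NonCoincident 3 n)) → (∀ u : ℕ → ℝ, Tendsto u atTop (𝓝[>] (0 : ℝ)) → ∀ (n : ℕ) (K : Set (Fin n → EuclideanSpace ℝ (Fin 3))), IsCompact K → K ⊆ NonCoincident 3 n → ∀ ε > 0, ∃ η > 0, ∀ᶠ k in atTop, ∀ x ∈ K, ∀ y ∈ K, dist x y < η → |rescaledCorrelator (criticalCorr 3) rhoPin n (u k) x - rescaledCorrelator (criticalCorr 3) rhoPin n (u k) y| < ε) → ∀ (n : ℕ) (x₀ : Fin n → EuclideanSpace ℝ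 (Fin 3)), x₀ ∈ NonCoincident 3 n → ∀ (Sa Sb : CorrFamily 3), IsClusterPoint Sa → IsClusterPoint Sb → ∀ v : ℝ, Sa n x₀ ≤ v → v ≤ Sb n x₀ → ∃ S : CorrFamily 3, IsClusterPoint S ∧ IsRegular S ∧ S n x₀ = v := by
  intro Δ c hc hG Hcpt Heq n x₀ hx₀ Sa Sb hSa hSb v hav hvb
  -- STEP 2: the endpoint values along the two cluster points' mesh sequences
  obtain ⟨ua, hua, hconva⟩ := hSa
  obtain ⟨ub, hub, hconvb⟩ := hSb
  have hA : Tendsto (fun k => rescaledCorrelator (criticalCorr 3) rhoPin n (ua k) x₀) atTop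
      (𝓝 (Sa n x₀)) := (hconva n).tendsto_at hx₀
  have hB : Tendsto (fun k => rescaledCorrelator (criticalCorr 3) rhoPin n (ub k) x₀) atTop
      (𝓝 (Sb n x₀)) := (hconvb n).tendsto_at hx₀
  -- STEPS 1 and 3: meshes `w k ≤ 1/(k+1)` with values `1/(k+1)`-close to `v`
  have hclaim : ∀ k : ℕ, ∃ δ : ℝ, 0 < δ ∧ δ < 1 / ((k : ℝ) + 1) ∧
      |rescaledCorrelator (criticalCorr 3) rhoPin n δ x₀ - v| < 1 / ((k : ℝ) + 1) := by
    intro k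
    have hk : (0 : ℝ) < 1 / ((k : ℝ) + 1) := Nat.one_div_pos_of_nat
    obtain ⟨δ₀, hδ₀, hosc⟩ := smallOscillation_iv hc hG Heq hx₀ hk
    exact exists_mesh_near_iv (g := fun δ => rescaledCorrelator (criticalCorr 3) rhoPin n δ x₀) hk hδ₀ hk
      hosc hua hub hA hB hav hvb
  choose w hw0 hw1 hwv using hclaim
  have hw : Tendsto w atTop (𝓝[>] (0 : ℝ)) :=
    tendsto_nhdsWithin_iff.2 ⟨squeeze_zero (fun k => (hw0 k).le) (fun k => (hw1 k).le)
      tendsto_one_div_add_atTop_nhds_zero_nat, Eventually.of_forall hw0⟩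
  -- a regular cluster point along a subsequence of `w`
  obtain ⟨φ, S, hφ, hreg, hconv⟩ := Hcpt w hw
  refine ⟨S, isClusterPoint_of_subseq hw hφ hconv, hreg, ?_⟩
  have h1 : Tendsto (fun k => rescaledCorrelator (criticalCorr 3) rhoPin n (w (φ k)) x₀) atTop
      (𝓝 (S n x₀)) := (hconv n).tendsto_at hx₀
  have h2 : Tendsto (fun k => rescaledCorrelator (criticalCorr 3) rhoPin n (w (φ k)) x₀) atTop (𝓝 v) := by
    rw [tendsto_iff_norm_sub_tendsto_zero]
    refine squeeze_zero (fun k => norm_nonneg _) (fun k => ?_) tendsto_one_div_add_atTop_nhds_zero_nat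
    rw [Real.norm_eq_abs]
    refine (hwv (φ k)).le.trans (one_div_le_one_div_of_le (by positivity) ?_)
    have hle : (k : ℝ) ≤ (φ k : ℝ) := Nat.cast_le.2 hφ.le_apply
    linarith
  exact tendsto_nhds_unique h1 h2

end Summit.CriticalPhenomena.Ising3DConformalLimit.MoebiusLimitExistsOnlyInteraction

end
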